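import Literature.NumberTheory.Automorphic.ReciprocityGLnLeavesProofs
import Literature.NumberTheory.GaloisRepresentations.FramedRepEquivConj
import HarnessLib

/-!
# Varma 2024, Cor. 9.3 (`Varma2024.corollary93_unramified`): reduction to lang.S27, proved

Topic `Literature/NumberTheory/Automorphic`.  A *proofs* file (theorems only, no new named fact,
D-0026) next to `ReciprocityGLnProofs`, which vendors the top layer of **lang.S27**
(`Literature.NumberTheory.Automorphic.exists_galoisRep_of_regularAlgebraic`): Harris–Lan–Taylor–
Thorne's Thm. A as the named facts `HarrisLanTaylorThorne2016.theoremA_existence` /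
`theoremA_uniqueness`, Varma's Cor. 9.3 in its unramified-place form
`Varma2024.corollary93_unramified`, and the proved assembly
`exists_galoisRep_of_regularAlgebraic_of : theoremA_existence → corollary93_unramified → lang.S27`.

Here the **converse reduction is proved**: `corollary93_unramified` follows from lang.S27 and the
uniqueness clause of Thm. A (`Varma2024.corollary93_unramified_of`), hence from lang.S27 and
Chebotarev's density theorem alone (`corollary93_unramified_of_chebotarev`, through
`HarrisLanTaylorThorne2016.theoremA_uniqueness_of_chebotarev` of `ReciprocityGLnLeavesProofs`:
Frobenius density + Brauer–Nesbitt, Flath's cofiniteness discharged).  So, granted Chebotarev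
(`chebotarev_artinRep`) and the existence half of Thm. A, the named fact `corollary93_unramified`
is **equivalent** to lang.S27 (`corollary93_unramified_iff`): it carries exactly the content of
Varma's theorem at the unramified places that HLTT's Thm. A does not reach (the places `v ∤ ℓ`
with `π_v` unramified but `π_w` ramified at another `w` over the same rational prime), no more.

Argument.  Let `r` be continuous semisimple with HLTT's property (`IsCompatible π ι r`).  By
lang.S27 there is a continuous semisimple `r₀` compatible with `π` at every `v ∤ ℓ`
(`IsGaloisCompatibleAt`), in particular HLTT-compatible (`isCompatible_of_forall_not_mem`); by the
uniqueness clause of Thm. A, `r₀ ≅ r` as continuous representations on `ℚ̄_ℓⁿ`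
(`ContinuousRep.Equiv`); and compatibility at a place is invariant under such isomorphisms
(`IsGaloisCompatibleAt.of_equiv`, from the G09 invariance lemmas
`FramedGaloisRep.isUnramifiedAt_of_equiv` / `FramedGaloisRep.hasFrobCharpolyAt_of_equiv` of
`GaloisRepresentations/FramedRepEquivConj`: equivalent framed representations are conjugate, and
conjugate matrices have equal characteristic polynomials).  This is how Varma's Cor. 9.3 (printed
as an existence statement for *the* `r_{p,ı}(π)` of HLTT) yields the vendored "for every
semisimple HLTT-compatible `r`" form (module docstring of `ReciprocityGLnProofs`).

Fact-owner's triage of `corollary93_unramified` itself (provefact unit, gen 1): **XL** — its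
genuine content is Varma's Thm. 1 / Thm. 9.2 (FMS numbering; arXiv:1411.2520v1: Thm. 1^{ss},
Thm. 10.2, Cor. 10.3, p. 24), whose printed proof runs through `p`-adic (overconvergent)
automorphic forms on the quasi-split unitary similitude group `U(n,n)/F⁺`, the action of the
Bernstein centre on them with local-Langlands traces (Prop. 7.1), Schneider–Zink types bounding
the monodromy (§9) and Sorensen's patching lemma (Cor. 10.3: "deduced from Theorem [10.2] by
using Lemma 1 of [So] using the same argument as in Theorem VII.1.9 of [HT]"); none of the local
Langlands correspondence `rec_{F_v}` for `GL_n`, Weil–Deligne representations, Shimura varieties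
or `p`-adic automorphic forms exists in Mathlib or in `Literature/`.  No discharge
`corollary93_unramified_holds` is possible today; this file records the exact residual content.

Places alone above their residue characteristic; `K = ℚ` (fact-owner, session 3).  The gap
between HLTT-compatibility and the conclusion of `corollary93_unramified` consists of the places
`v ∤ ℓ` with `π_v` unramified and `π_w` ramified at another place `w` over the same rational
prime.  At a place `v` which is the *only* place of `K` above its residue characteristic there
is no such `w`, so HLTT-compatibility already gives compatibility at `v`
(`HarrisLanTaylorThorne2016.IsCompatible.isGaloisCompatibleAt_of_forall_eq`, proved).  Over
`K = ℚ` every finite place is of this kind (`heightOneSpectrum_rat_eq_of_natCast_mem`), so the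
conclusion of `corollary93_unramified` holds over `ℚ` outright, from `IsCompatible` alone
(`Varma2024.corollary93_unramified_rat`), and **lang.S27 over `ℚ` follows from the existence
half of Harris–Lan–Taylor–Thorne's Thm. A alone** (`exists_galoisRep_of_regularAlgebraic_rat_of`):
for `GL_n/ℚ` Varma's theorem is not needed at the unramified places.  (For `K ≠ ℚ` infinitely
many rational primes have several places above them, and the residual content is genuine.)

## References

* I. Varma, *Local-global compatibility for regular algebraic cuspidal automorphic
  representations when `ℓ ≠ p`*, Forum Math. Sigma 12 (2024), e21, doi:10.1017/fms.2024.7 —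
  Thm. 1–2 (p. 2), Thm. 9.2, Cor. 9.3 (p. 32); = arXiv:1411.2520v1, Thm. 1^{ss} / Thm. 1 (p. 3),
  Thm. 10.2, Cor. 10.3 (p. 24). [VarmaFMS2024]
* M. Harris, K.-W. Lan, R. Taylor, J. Thorne, *On the rigid cohomology of certain Shimura
  varieties*, Res. Math. Sci. 3:37 (2016), Thm. A (p. 3), uniqueness clause.
  [HarrisLanTaylorThorneRMS2016]
* P. Deligne, J.-P. Serre, *Formes modulaires de poids 1*, Ann. Sci. ÉNS 7 (1974), Lemme 3.2
  (p. 513). [DeligneSerreASENS1974]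
-/

noncomputable section

open scoped MatrixGroups Matrix Classical Polynomial NumberField
open NumberField IsDedekindDomain Field Polynomial Literature.NumberTheory.Automorphic

namespace Literature.NumberTheory.Automorphic

/-! ## Compatibility at a place is invariant under isomorphism -/

section Transport

variable {n : ℕ} {K : Type} [Field K] [NumberField K] {hcpt : isCompact_glFiniteIntegralLevel n K}
  {ℓ : ℕ} [Fact ℓ.Prime]

/-- **Unramified local–global compatibility with `π` at `v` is invariant under isomorphism** of
the underlying continuous representations on `ℚ̄_ℓⁿ` (`ContinuousRep.Equiv`): unramifiedness and
the characteristic polynomial of arithmetic Frobenius are invariants of the isomorphism class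
(`FramedGaloisRep.isUnramifiedAt_of_equiv`, `FramedGaloisRep.hasFrobCharpolyAt_of_equiv` of
`GaloisRepresentations/FramedRepEquivConj`).  This is the step by which a statement about *the*
representation `r_{ℓ,ι}(π)` (unique up to isomorphism, Harris–Lan–Taylor–Thorne 2016, Thm. A)
becomes a statement about every semisimple representation with its characterising property.
[folklore] -/
theorem IsGaloisCompatibleAt.of_equiv {π : AutomorphicRepData (AutomorphyDatum.gl n K hcpt)}
    {ι : PadicAlgCl ℓ ≃+* ℂ} {r r' : GaloisRepresentations.FramedGaloisRep K (PadicAlgCl ℓ) n}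
    {v : HeightOneSpectrum (𝓞 K)} (h : IsGaloisCompatibleAt π ι r v)
    (e : GaloisRepresentations.ContinuousRep.Equiv r.toGaloisRep r'.toGaloisRep) :
    IsGaloisCompatibleAt π ι r' v := fun α hα ↦
  ⟨GaloisRepresentations.FramedGaloisRep.isUnramifiedAt_of_equiv e (h α hα).1,
    GaloisRepresentations.FramedGaloisRep.hasFrobCharpolyAt_of_equiv e (h α hα).2⟩

/-- HLTT-compatibility (`HarrisLanTaylorThorne2016.IsCompatible`) is invariant under isomorphism
of the underlying continuous representations (`IsGaloisCompatibleAt.of_equiv`). [folklore] -/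
theorem HarrisLanTaylorThorne2016.IsCompatible.of_equiv
    {π : AutomorphicRepData (AutomorphyDatum.gl n K hcpt)} {ι : PadicAlgCl ℓ ≃+* ℂ}
    {r r' : GaloisRepresentations.FramedGaloisRep K (PadicAlgCl ℓ) n}
    (h : HarrisLanTaylorThorne2016.IsCompatible π ι r)
    (e : GaloisRepresentations.ContinuousRep.Equiv r.toGaloisRep r'.toGaloisRep) :
    HarrisLanTaylorThorne2016.IsCompatible π ι r' :=
  fun q hq hqℓ hπq v hv ↦ (h q hq hqℓ hπq v hv).of_equiv e

end Transport

/-! ## `corollary93_unramified` from lang.S27 and the uniqueness clause of Thm. A -/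

namespace Varma2024

/-- **Varma 2024, Cor. 9.3 (unramified places) from lang.S27 and the uniqueness clause of
Harris–Lan–Taylor–Thorne's Thm. A, proved.**  Granted lang.S27
(`exists_galoisRep_of_regularAlgebraic`: a continuous semisimple `r₀ : Γ_K → GL_n(ℚ̄_ℓ)`
compatible with `π` at every `v ∤ ℓ`) and `HarrisLanTaylorThorne2016.theoremA_uniqueness`, every
continuous semisimple `r` with HLTT's property (`IsCompatible π ι r`) is compatible with `π` at
every `v ∤ ℓ`: `r₀` is in particular HLTT-compatible (`isCompatible_of_forall_not_mem`), so
`r₀ ≅ r` by uniqueness, and compatibility at `v` transports along the isomorphism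
(`IsGaloisCompatibleAt.of_equiv`).  Converse of the assembly
`exists_galoisRep_of_regularAlgebraic_of` (`ReciprocityGLnProofs`).
[cite: VarmaFMS2024, Cor. 9.3 (p. 32) (= arXiv:1411.2520v1, Cor. 10.3, p. 24)]
[cite: HarrisLanTaylorThorneRMS2016, Thm. A (p. 3), uniqueness clause] -/
theorem corollary93_unramified_of (hU : HarrisLanTaylorThorne2016.theoremA_uniqueness)
    (hS : exists_galoisRep_of_regularAlgebraic) : corollary93_unramified := by
  intro n K _ _ hcpt hK π hπ ℓ _ ι r hr hc v hv
  obtain ⟨r₀, hr₀, hc₀⟩ := hS hcpt hK π hπ ℓ ι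
  have hc₀' : ∀ w : HeightOneSpectrum (𝓞 K), ((ℓ : ℕ) : 𝓞 K) ∉ w.asIdeal →
      IsGaloisCompatibleAt π.1 ι r₀ w := fun w hw α hα ↦ hc₀ w α hα hw
  obtain ⟨e⟩ := hU hcpt hK π hπ ℓ ι r₀ r hr₀ hr
    (HarrisLanTaylorThorne2016.isCompatible_of_forall_not_mem hc₀') hc
  exact (hc₀' v hv).of_equiv e

/-- **Varma 2024, Cor. 9.3 (unramified places) from lang.S27 and Chebotarev's density theorem
alone**: `corollary93_unramified_of` with the uniqueness clause of Thm. A discharged down to the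
named fact `chebotarev_artinRep` (`HarrisLanTaylorThorne2016.theoremA_uniqueness_of_chebotarev`,
`ReciprocityGLnLeavesProofs`: density of Frobenius elements, Brauer–Nesbitt, Flath's "unramified
almost everywhere" proved).
[cite: VarmaFMS2024, Cor. 9.3 (p. 32) (= arXiv:1411.2520v1, Cor. 10.3, p. 24)] -/
theorem corollary93_unramified_of_chebotarev (hC : chebotarev_artinRep)
    (hS : exists_galoisRep_of_regularAlgebraic) : corollary93_unramified :=
  corollary93_unramified_of (HarrisLanTaylorThorne2016.theoremA_uniqueness_of_chebotarev hC) hS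

/-- **What the named fact `corollary93_unramified` amounts to.**  Granted Chebotarev's density
theorem (`chebotarev_artinRep`) and the existence half of Harris–Lan–Taylor–Thorne's Thm. A
(`HarrisLanTaylorThorne2016.theoremA_existence`), Varma's Cor. 9.3 in its vendored
unramified-place form is *equivalent* to lang.S27 (`exists_galoisRep_of_regularAlgebraic`):
`→` is the assembly `exists_galoisRep_of_regularAlgebraic_of`, `←` is
`corollary93_unramified_of_chebotarev`.  The residual content of either is Varma's theorem at the
places `v ∤ ℓ` where `π_v` is unramified but `π` is ramified at another place over the same
rational prime — the places not reached by Thm. A.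
[cite: VarmaFMS2024, Thm. 1 (p. 2) and Cor. 9.3 (p. 32)]
[cite: HarrisLanTaylorThorneRMS2016, Thm. A (p. 3)] -/
theorem corollary93_unramified_iff (hC : chebotarev_artinRep)
    (hA : HarrisLanTaylorThorne2016.theoremA_existence) :
    corollary93_unramified ↔ exists_galoisRep_of_regularAlgebraic :=
  ⟨exists_galoisRep_of_regularAlgebraic_of hA, corollary93_unramified_of_chebotarev hC⟩

end Varma2024

/-! ## Places alone above their residue characteristic; the case `K = ℚ` -/

section UniquePlace

variable {n : ℕ} {K : Type} [Field K] [NumberField K] {hcpt : isCompact_glFiniteIntegralLevel n K}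
  {ℓ : ℕ} [Fact ℓ.Prime]

/-- **HLTT-compatibility reaches every place that is alone above its residue characteristic.**
If `r` has Harris–Lan–Taylor–Thorne's property with respect to `π` (`IsCompatible π ι r`:
compatibility at every place over each rational prime `q ≠ ℓ` above which `π` is unramified at
*all* places) and `v ∤ ℓ` is the only finite place of `K` containing its residue characteristic,
then `r` is compatible with `π` at `v` (`IsGaloisCompatibleAt`): if `π_v` is unramified then `π`
is unramified above the rational prime `q` below `v` (its only place being `v`), and `q ≠ ℓ`
since `v ∤ ℓ`.  The conclusion of `Varma2024.corollary93_unramified` at such places, from Thm. A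
alone. [cite: HarrisLanTaylorThorneRMS2016, Thm. A (p. 3)] -/
theorem HarrisLanTaylorThorne2016.IsCompatible.isGaloisCompatibleAt_of_forall_eq
    {π : AutomorphicRepData (AutomorphyDatum.gl n K hcpt)} {ι : PadicAlgCl ℓ ≃+* ℂ}
    {r : GaloisRepresentations.FramedGaloisRep K (PadicAlgCl ℓ) n}
    (hc : HarrisLanTaylorThorne2016.IsCompatible π ι r) {v : HeightOneSpectrum (𝓞 K)}
    (hv : ((ℓ : ℕ) : 𝓞 K) ∉ v.asIdeal)
    (huniq : ∀ q : ℕ, q.Prime → ((q : ℕ) : 𝓞 K) ∈ v.asIdeal →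
      ∀ w : HeightOneSpectrum (𝓞 K), ((q : ℕ) : 𝓞 K) ∈ w.asIdeal → w = v) :
    IsGaloisCompatibleAt π ι r v := by
  intro α hα
  obtain ⟨q, hq, hqv⟩ := exists_natPrime_natCast_mem v
  have hqℓ : q ≠ ℓ := by
    rintro rfl
    exact hv hqv
  have hunr : π.IsUnramifiedAbove q := fun w hw ↦ by
    obtain rfl := huniq q hq hqv w hw
    exact ⟨α, hα⟩
  exact hc q hq hqℓ hunr v hqv α hα

/-- **Over `ℚ` a rational prime lies under exactly one finite place**: two finite places of `ℚ`
containing the same rational prime `q` coincide (under Mathlib's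
`Rat.HeightOneSpectrum.primesEquiv : HeightOneSpectrum (𝓞 ℚ) ≃ Nat.Primes` both are sent to
`q`, the positive generator of the corresponding ideal of `ℤ`). [folklore] -/
theorem heightOneSpectrum_rat_eq_of_natCast_mem {q : ℕ} (hq : q.Prime)
    {v w : HeightOneSpectrum (𝓞 ℚ)} (hv : ((q : ℕ) : 𝓞 ℚ) ∈ v.asIdeal)
    (hw : ((q : ℕ) : 𝓞 ℚ) ∈ w.asIdeal) : v = w := by
  have key : ∀ u : HeightOneSpectrum (𝓞 ℚ), ((q : ℕ) : 𝓞 ℚ) ∈ u.asIdeal →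
      Rat.HeightOneSpectrum.natGenerator u = q := fun u hu ↦ by
    have hdvd : Rat.HeightOneSpectrum.natGenerator u ∣ q := by
      rw [Rat.HeightOneSpectrum.natGenerator_dvd_iff]
      simpa only [map_natCast] using
        Ideal.mem_map_of_mem (Rat.IsIntegralClosure.intEquiv (𝓞 ℚ)) hu
    exact (Nat.prime_dvd_prime_iff_eq (Rat.HeightOneSpectrum.prime_natGenerator u) hq).1 hdvd
  refine (Rat.HeightOneSpectrum.primesEquiv (R := 𝓞 ℚ)).injective (Subtype.ext ?_)
  change Rat.HeightOneSpectrum.natGenerator v = Rat.HeightOneSpectrum.natGenerator w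
  rw [key v hv, key w hw]

/-- **Varma 2024, Cor. 9.3 (unramified places) over `K = ℚ` — proved, from HLTT-compatibility
alone.**  For `π` an automorphic representation of `GL_n(𝔸_ℚ)`, `ι : ℚ̄_ℓ ≃+* ℂ` and
`r : Γ_ℚ → GL_n(ℚ̄_ℓ)` with Harris–Lan–Taylor–Thorne's property (`IsCompatible π ι r`), `r` is
compatible with `π` at **every** `v ∤ ℓ` (`IsGaloisCompatibleAt`: unramified with the predicted
characteristic polynomial of Frobenius wherever `π_v` is unramified): every finite place of `ℚ`
is alone above its residue characteristic (`heightOneSpectrum_rat_eq_of_natCast_mem`,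
`IsCompatible.isGaloisCompatibleAt_of_forall_eq`).  This is the `K = ℚ` instance of the
conclusion of the named fact `corollary93_unramified`, with its hypotheses "`π` cuspidal regular
algebraic, `r` semisimple" not even needed; over `ℚ` the places "`π_v` unramified but `π`
ramified elsewhere above the same rational prime", where Varma's theorem is the only source, do
not exist. [cite: VarmaFMS2024, Cor. 9.3 (p. 32)] [cite: HarrisLanTaylorThorneRMS2016, Thm. A (p. 3)] -/
theorem Varma2024.corollary93_unramified_rat {n : ℕ} {hcpt : isCompact_glFiniteIntegralLevel n ℚ}
    {ℓ : ℕ} [Fact ℓ.Prime] {π : AutomorphicRepData (AutomorphyDatum.gl n ℚ hcpt)}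
    {ι : PadicAlgCl ℓ ≃+* ℂ} {r : GaloisRepresentations.FramedGaloisRep ℚ (PadicAlgCl ℓ) n}
    (hc : HarrisLanTaylorThorne2016.IsCompatible π ι r) (v : HeightOneSpectrum (𝓞 ℚ))
    (hv : ((ℓ : ℕ) : 𝓞 ℚ) ∉ v.asIdeal) : IsGaloisCompatibleAt π ι r v :=
  hc.isGaloisCompatibleAt_of_forall_eq hv fun _q hq hqv _w hw ↦
    heightOneSpectrum_rat_eq_of_natCast_mem hq hw hqv

/-- **lang.S27 over `ℚ` from the existence half of Harris–Lan–Taylor–Thorne's Thm. A alone**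
(no appeal to Varma's theorem): for `π` a regular algebraic cuspidal automorphic representation
of `GL_n(𝔸_ℚ)`, a prime `ℓ` and `ι : ℚ̄_ℓ ≃+* ℂ`, there is a continuous semisimple
`r : Γ_ℚ → GL_n(ℚ̄_ℓ)` unramified at every `p ≠ ℓ` at which `π` is unramified, with arithmetic
Frobenius of characteristic polynomial `arithFrobPolyOfSatake ι p n α` for the Satake parameter
`α` of `π_p` — the `K = ℚ` instance of `exists_galoisRep_of_regularAlgebraic`, assembled from
`theoremA_existence` (`ℚ` is totally real, Mathlib instance) and `corollary93_unramified_rat`.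
[cite: HarrisLanTaylorThorneRMS2016, Thm. A (p. 3) and Cor. 7.14 (p. 232)] -/
theorem exists_galoisRep_of_regularAlgebraic_rat_of
    (hA : HarrisLanTaylorThorne2016.theoremA_existence) {n : ℕ}
    (hcpt : isCompact_glFiniteIntegralLevel n ℚ) (π : CuspidalAutomorphicRepData n ℚ hcpt)
    (hπ : π.1.IsRegularAlgebraic) (ℓ : ℕ) [Fact ℓ.Prime] (ι : PadicAlgCl ℓ ≃+* ℂ) :
    ∃ r : GaloisRepresentations.FramedGaloisRep ℚ (PadicAlgCl ℓ) n, r.toGaloisRep.IsSemisimple ∧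
      ∀ (v : HeightOneSpectrum (𝓞 ℚ)) (α : Multiset ℂ), π.1.HasSatakeParamAt v α →
        ((ℓ : ℕ) : 𝓞 ℚ) ∉ v.asIdeal →
          r.IsUnramifiedAt v ∧ r.HasFrobCharpolyAt v (arithFrobPolyOfSatake ι v.residueCard n α) := by
  obtain ⟨r, hr, hc⟩ := hA hcpt (Or.inl inferInstance) π hπ ℓ ι
  exact ⟨r, hr, fun v α hα hv ↦ Varma2024.corollary93_unramified_rat hc v hv α hα⟩

end UniquePlace

end Literature.NumberTheory.Automorphic
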